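import Literature.AlgebraicGeometry.ModuliOfAbelianVarieties.SiegelModuliInterpretation
import HarnessLib

/-!
# Transport of a T1′ marking along the rational move `(J, a) ↦ (qJq⁻¹, q·a)`, `q ∈ GSp_δ(ℚ)` (W1 / W0 / W3 junction (T1))

Cell hodgecm-mathlib, rung 0 on `hDel`; the (P)-skeleton's `MarkedBy J a P′` (`B-plan/lines/m1prime/M1primeOfFU.skeleton` :2243)
must be TRANSPORTED along equalities `[J, a] = [J′, a′]` of the Siegel Shimura set (★ `SiegelShimuraSet.mk_eq_mk_iff`:
`J = γJ′γ⁻¹`, `aK = γa′K`, `γ ∈ GSp_δ(ℚ)`) — for W1's Dictionary at arbitrary `(J, a)`, for «W0 from (U3∃)», and for W3's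
normalisation to principal representatives (B-p05 spec 00:20:32Z, (T) = (T1) ∘ (T2)).  This file is (T1), the RATIONAL move
([Milne2005ShimuraVarieties] §6 p. 75: the triple of `[J, a]` and of `[qJq⁻¹, qa]` is the SAME — `q : (V, J, Λ_a) ⥲ (V, qJq⁻¹, Λ_{qa})`):

* `SiegelAdelicMarking.rationalMove m q : SiegelAdelicMarking (conjAct δ (gspRationalToReal δ q) J) (gspRationalToFinAdelic δ q * a) A`
  — same abelian variety, same uniformisation `toFun`, same `Ψ`, basis matrix `γ ↦ q·γ`;
* `SiegelAdelicMarking.rationalMove_r` — its torsion parametrisation is `v ↦ r (q⁻¹ v)`.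

No carrier, no fact; theorems + one `def` (the transported structure).  HC_CM is proved only modulo the 7 printed citations until
rung 0 closes; this file discharges none of them.

## References
* [Milne2005ShimuraVarieties] J. S. Milne, *Introduction to Shimura varieties* (2005), §5 (5.1) p. 56, §6 Thm. 6.11 p. 74 and p. 75.
* [Deligne1971TravauxShimura] P. Deligne, *Travaux de Shimura* (1971), 4.11–4.12 pp. 148–149.
-/

set_option autoImplicit false

noncomputable section

open Matrix NumberField IsDedekindDomain CategoryTheory

namespace Literature.AlgebraicGeometry.ModuliOfAbelianVarieties

open Literature.AlgebraicGeometry.Motives (AbelianVariety)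
open Literature.Geometry.Kaehler (ComplexTorus)

variable {g : ℕ} {δ : Fin g → ℕ} {J : C0pm δ} {a : gspFinAdelic δ} {A : AbelianVariety ℂ}

namespace SiegelAdelicMarking

/-- `adelicMatrix` is multiplicative (it is `Matrix.map` of a ring homomorphism). [folklore] -/
private theorem adelicMatrix_mul (M N : Matrix (Fin g ⊕ Fin g) (Fin g ⊕ Fin g) ℚ) :
    adelicMatrix (M * N) = adelicMatrix M * adelicMatrix N := by
  unfold adelicMatrix; rw [Matrix.map_mul]

/-- The adelic image of `q ∈ GSp_δ(ℚ)` as a matrix is `adelicMatrix q`. [folklore] -/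
private theorem coe_toFinAdelic (q : gspRational δ) :
    (((gspRationalToFinAdelic δ q : gspFinAdelic δ) : GL (Fin g ⊕ Fin g) finAdeleQ) :
        Matrix (Fin g ⊕ Fin g) (Fin g ⊕ Fin g) finAdeleQ) =
      adelicMatrix (((q : gspRational δ) : GL (Fin g ⊕ Fin g) ℚ) : Matrix (Fin g ⊕ Fin g) (Fin g ⊕ Fin g) ℚ) := rfl

/-- … and that of `q⁻¹` is `adelicMatrix q⁻¹`. [folklore] -/
private theorem coe_toFinAdelic_inv (q : gspRational δ) :
    ((((gspRationalToFinAdelic δ q : gspFinAdelic δ))⁻¹ : GL (Fin g ⊕ Fin g) finAdeleQ) :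
        Matrix (Fin g ⊕ Fin g) (Fin g ⊕ Fin g) finAdeleQ) =
      adelicMatrix ((((q : gspRational δ) : GL (Fin g ⊕ Fin g) ℚ)⁻¹ : GL (Fin g ⊕ Fin g) ℚ) :
        Matrix (Fin g ⊕ Fin g) (Fin g ⊕ Fin g) ℚ) := by
  rw [← Subgroup.coe_inv, ← map_inv]; rfl

/-- The real image of `q ∈ GSp_δ(ℚ)` as a matrix is `q.map (algebraMap ℚ ℝ)` (and likewise for `q⁻¹`). [folklore] -/
private theorem coe_toReal (q : gspRational δ) :
    (((gspRationalToReal δ q : gspReal δ) : GL (Fin g ⊕ Fin g) ℝ) : Matrix (Fin g ⊕ Fin g) (Fin g ⊕ Fin g) ℝ) =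
      (((q : gspRational δ) : GL (Fin g ⊕ Fin g) ℚ) : Matrix (Fin g ⊕ Fin g) (Fin g ⊕ Fin g) ℚ).map (algebraMap ℚ ℝ) := rfl

/-- … and that of `q⁻¹` (helper). [folklore] -/
private theorem coe_toReal_inv (q : gspRational δ) :
    ((((gspRationalToReal δ q : gspReal δ) : GL (Fin g ⊕ Fin g) ℝ)⁻¹ : GL (Fin g ⊕ Fin g) ℝ) :
        Matrix (Fin g ⊕ Fin g) (Fin g ⊕ Fin g) ℝ) =
      ((((q : gspRational δ) : GL (Fin g ⊕ Fin g) ℚ)⁻¹ : GL (Fin g ⊕ Fin g) ℚ) :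
        Matrix (Fin g ⊕ Fin g) (Fin g ⊕ Fin g) ℚ).map (algebraMap ℚ ℝ) := by
  rw [← Subgroup.coe_inv, ← map_inv]; rfl

/-- `adelicMatrix` of a product in `GL_{2g}(ℚ)`. [folklore] -/
private theorem adelicMatrix_coe_mul (x y : GL (Fin g ⊕ Fin g) ℚ) :
    adelicMatrix ((x * y : GL (Fin g ⊕ Fin g) ℚ) : Matrix (Fin g ⊕ Fin g) (Fin g ⊕ Fin g) ℚ) =
      adelicMatrix (x : Matrix (Fin g ⊕ Fin g) (Fin g ⊕ Fin g) ℚ) * adelicMatrix (y : Matrix (Fin g ⊕ Fin g) (Fin g ⊕ Fin g) ℚ) := by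
  rw [Units.val_mul, adelicMatrix_mul]

/-- `adelicMatrix q⁻¹ * adelicMatrix q = 1`. [folklore] -/
private theorem adelicMatrix_inv_mul (x : GL (Fin g ⊕ Fin g) ℚ) :
    adelicMatrix ((x⁻¹ : GL (Fin g ⊕ Fin g) ℚ) : Matrix (Fin g ⊕ Fin g) (Fin g ⊕ Fin g) ℚ) *
      adelicMatrix (x : Matrix (Fin g ⊕ Fin g) (Fin g ⊕ Fin g) ℚ) = 1 := by
  rw [← adelicMatrix_mul, ← Units.val_mul, inv_mul_cancel, Units.val_one]
  unfold adelicMatrix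
  rw [Matrix.map_one _ (map_zero _) (map_one _)]

/-- The real matrix of `q⁻¹` times that of `q` is `1`. [folklore] -/
private theorem realMatrix_inv_mul (x : GL (Fin g ⊕ Fin g) ℚ) :
    ((x⁻¹ : GL (Fin g ⊕ Fin g) ℚ) : Matrix (Fin g ⊕ Fin g) (Fin g ⊕ Fin g) ℚ).map (algebraMap ℚ ℝ) *
      (x : Matrix (Fin g ⊕ Fin g) (Fin g ⊕ Fin g) ℚ).map (algebraMap ℚ ℝ) = 1 := by
  rw [← Matrix.map_mul, ← Units.val_mul, inv_mul_cancel, Units.val_one, Matrix.map_one _ (map_zero _) (map_one _)]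

section Move

variable (m : SiegelAdelicMarking J a A) (q : gspRational δ)

/-- `IsLatticeBasis (q·a) (q·γ)`: `Λ_{qa} = qΛ_a` has basis matrix `qγ`. [cite: Milne2005ShimuraVarieties, §6 p. 75] -/
theorem isLatticeBasis_rationalMove :
    IsLatticeBasis ((gspRationalToFinAdelic δ q : gspFinAdelic δ) * a) ((q : GL (Fin g ⊕ Fin g) ℚ) * m.γ) := by
  intro i j
  have h1 : adelicMatrix (((((q : gspRational δ) : GL (Fin g ⊕ Fin g) ℚ) * m.γ)⁻¹ : GL (Fin g ⊕ Fin g) ℚ) :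
        Matrix (Fin g ⊕ Fin g) (Fin g ⊕ Fin g) ℚ) *
      ((((gspRationalToFinAdelic δ q : gspFinAdelic δ) * a : gspFinAdelic δ) : GL (Fin g ⊕ Fin g) finAdeleQ) :
        Matrix (Fin g ⊕ Fin g) (Fin g ⊕ Fin g) finAdeleQ) =
      adelicMatrix ((m.γ⁻¹ : GL (Fin g ⊕ Fin g) ℚ) : Matrix (Fin g ⊕ Fin g) (Fin g ⊕ Fin g) ℚ) *
        ((a : GL (Fin g ⊕ Fin g) finAdeleQ) : Matrix (Fin g ⊕ Fin g) (Fin g ⊕ Fin g) finAdeleQ) := by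
    rw [_root_.mul_inv_rev, adelicMatrix_coe_mul, Subgroup.coe_mul, Units.val_mul, coe_toFinAdelic, Matrix.mul_assoc]
    congr 1
    rw [← Matrix.mul_assoc, adelicMatrix_inv_mul, Matrix.one_mul]
  have h2 : (((((gspRationalToFinAdelic δ q : gspFinAdelic δ) * a)⁻¹ : gspFinAdelic δ) : GL (Fin g ⊕ Fin g) finAdeleQ) :
        Matrix (Fin g ⊕ Fin g) (Fin g ⊕ Fin g) finAdeleQ) *
      adelicMatrix ((((q : gspRational δ) : GL (Fin g ⊕ Fin g) ℚ) * m.γ : GL (Fin g ⊕ Fin g) ℚ) :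
        Matrix (Fin g ⊕ Fin g) (Fin g ⊕ Fin g) ℚ) =
      (((a⁻¹ : gspFinAdelic δ) : GL (Fin g ⊕ Fin g) finAdeleQ) : Matrix (Fin g ⊕ Fin g) (Fin g ⊕ Fin g) finAdeleQ) *
        adelicMatrix ((m.γ : GL (Fin g ⊕ Fin g) ℚ) : Matrix (Fin g ⊕ Fin g) (Fin g ⊕ Fin g) ℚ) := by
    simp only [Subgroup.coe_inv, Subgroup.coe_mul, _root_.mul_inv_rev, Units.val_mul, coe_toFinAdelic_inv, adelicMatrix_mul,
      Matrix.mul_assoc]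
    congr 1
    rw [← Matrix.mul_assoc, adelicMatrix_inv_mul, Matrix.one_mul]
  rw [h1, h2]
  exact m.γ_isLatticeBasis i j

/-- The chart identity `Ψ((qγ)⁻¹ (qJq⁻¹) x) = i·Ψ((qγ)⁻¹ x)` of the moved marking. [cite: Milne2005ShimuraVarieties, §6 p. 75] -/
theorem Ψ_J_rationalMove (x : Fin g ⊕ Fin g → ℝ) :
    m.Ψ ((((((q : gspRational δ) : GL (Fin g ⊕ Fin g) ℚ) * m.γ)⁻¹ : GL (Fin g ⊕ Fin g) ℚ) :
          Matrix (Fin g ⊕ Fin g) (Fin g ⊕ Fin g) ℚ).map (algebraMap ℚ ℝ) *ᵥ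
        (((conjAct δ (gspRationalToReal δ q) J : C0pm δ) : Matrix (Fin g ⊕ Fin g) (Fin g ⊕ Fin g) ℝ) *ᵥ x)) =
      Complex.I • m.Ψ ((((((q : gspRational δ) : GL (Fin g ⊕ Fin g) ℚ) * m.γ)⁻¹ : GL (Fin g ⊕ Fin g) ℚ) :
          Matrix (Fin g ⊕ Fin g) (Fin g ⊕ Fin g) ℚ).map (algebraMap ℚ ℝ) *ᵥ x) := by
  have hinv : (((((q : gspRational δ) : GL (Fin g ⊕ Fin g) ℚ) * m.γ)⁻¹ : GL (Fin g ⊕ Fin g) ℚ) :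
        Matrix (Fin g ⊕ Fin g) (Fin g ⊕ Fin g) ℚ).map (algebraMap ℚ ℝ) =
      ((m.γ⁻¹ : GL (Fin g ⊕ Fin g) ℚ) : Matrix (Fin g ⊕ Fin g) (Fin g ⊕ Fin g) ℚ).map (algebraMap ℚ ℝ) *
        ((((q : gspRational δ) : GL (Fin g ⊕ Fin g) ℚ)⁻¹ : GL (Fin g ⊕ Fin g) ℚ) :
          Matrix (Fin g ⊕ Fin g) (Fin g ⊕ Fin g) ℚ).map (algebraMap ℚ ℝ) := by
    rw [_root_.mul_inv_rev, Units.val_mul, Matrix.map_mul]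
  have hQQv : ∀ y : Fin g ⊕ Fin g → ℝ,
      ((((q : gspRational δ) : GL (Fin g ⊕ Fin g) ℚ)⁻¹ : GL (Fin g ⊕ Fin g) ℚ) : Matrix (Fin g ⊕ Fin g) (Fin g ⊕ Fin g) ℚ).map
          (algebraMap ℚ ℝ) *ᵥ
        ((((q : gspRational δ) : GL (Fin g ⊕ Fin g) ℚ) : Matrix (Fin g ⊕ Fin g) (Fin g ⊕ Fin g) ℚ).map (algebraMap ℚ ℝ) *ᵥ y) = y :=
    fun y => by rw [Matrix.mulVec_mulVec, realMatrix_inv_mul, Matrix.one_mulVec]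
  rw [hinv, coe_conjAct, conjJ_def, coe_toReal, coe_toReal_inv]
  simp only [← Matrix.mulVec_mulVec]
  rw [hQQv]
  exact m.Ψ_J _

/-- **THE RATIONAL MOVE OF A MARKING**: a marking of `A` by `[J, a]` IS a marking of the same `A` by `[qJq⁻¹, q·a]` for every
`q ∈ GSp_δ(ℚ)` — same uniformisation `toFun`, same complex chart `Ψ`, basis matrix `qγ` of `Λ_{qa} = qΛ_a` (Milne: the
triples of `[J, a]` and `[qJq⁻¹, qa]` coincide, `q` being an isomorphism of the rational data).
[cite: Milne2005ShimuraVarieties, §6 Thm. 6.11 p. 74 and p. 75] [cite: Deligne1971TravauxShimura, 4.11–4.12 pp. 148–149] -/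
def rationalMove : SiegelAdelicMarking (conjAct δ (gspRationalToReal δ q) J) ((gspRationalToFinAdelic δ q : gspFinAdelic δ) * a) A where
  γ := (q : GL (Fin g ⊕ Fin g) ℚ) * m.γ
  γ_isLatticeBasis := m.isLatticeBasis_rationalMove q
  Ψ := m.Ψ
  Ψ_J := m.Ψ_J_rationalMove q
  toFun := m.toFun
  isAnalytification := m.isAnalytification
  toFun_add := m.toFun_add

/-- The moved marking has the same uniformisation (the triple of `[qJq⁻¹, qa]` has the same abelian variety). [cite: Milne2005ShimuraVarieties, §6 p. 75] -/
@[simp] theorem rationalMove_toFun : (m.rationalMove q).toFun = m.toFun := rfl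

/-- The moved marking has the same complex chart `Ψ`. [cite: Milne2005ShimuraVarieties, §6 p. 75] -/
@[simp] theorem rationalMove_Ψ : (m.rationalMove q).Ψ = m.Ψ := rfl

/-- The moved marking has basis matrix `qγ` (`Λ_{qa} = qΛ_a`). [cite: Milne2005ShimuraVarieties, §6 p. 75] -/
@[simp] theorem rationalMove_γ : (m.rationalMove q).γ = (q : GL (Fin g ⊕ Fin g) ℚ) * m.γ := rfl

/-- **The torsion parametrisation of the moved marking is `v ↦ r (q⁻¹ v)`** (`η_{qa} = η_a ∘ q⁻¹` on `V`).
[cite: Milne2005ShimuraVarieties, §6 p. 75] -/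
theorem rationalMove_r (v : Fin g ⊕ Fin g → ℚ) :
    (m.rationalMove q).r v =
      m.r (((((q : gspRational δ) : GL (Fin g ⊕ Fin g) ℚ)⁻¹ : GL (Fin g ⊕ Fin g) ℚ) :
        Matrix (Fin g ⊕ Fin g) (Fin g ⊕ Fin g) ℚ) *ᵥ v) := by
  rw [r_def, r_def, rationalMove_toFun, rationalMove_Ψ, rationalMove_γ, _root_.mul_inv_rev, Units.val_mul,
    ← Matrix.mulVec_mulVec]

/-- **The congruence clause moves with `q`**: `(q̂·a)⁻¹·v̂ ≡ b′·ŵ` iff `a⁻¹·(q⁻¹v)^ ≡ b′·ŵ` (mod `ẑ^{2g}`) — `(q̂a)⁻¹ v̂ = a⁻¹ (q⁻¹ v)^`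
(★ `adelicMatrix_mulVec_adelicVec`); so the tower clause of a symplectic lift for the moved marking at `v` is the clause for the
original marking at `q⁻¹ v`. [cite: Milne2005ShimuraVarieties, §6 p. 75] -/
theorem adelicCongr_rationalMove_iff (b' : GL (Fin g ⊕ Fin g) finAdeleQ) (v w : Fin g ⊕ Fin g → ℚ) :
    AdelicCongr ((((gspRationalToFinAdelic δ q : gspFinAdelic δ) * a)⁻¹ : gspFinAdelic δ) : GL (Fin g ⊕ Fin g) finAdeleQ) b' v w ↔
      AdelicCongr ((a⁻¹ : gspFinAdelic δ) : GL (Fin g ⊕ Fin g) finAdeleQ) b'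
        (((((q : gspRational δ) : GL (Fin g ⊕ Fin g) ℚ)⁻¹ : GL (Fin g ⊕ Fin g) ℚ) : Matrix (Fin g ⊕ Fin g) (Fin g ⊕ Fin g) ℚ) *ᵥ v)
        w := by
  have h : (((((gspRationalToFinAdelic δ q : gspFinAdelic δ) * a)⁻¹ : gspFinAdelic δ) : GL (Fin g ⊕ Fin g) finAdeleQ) :
        Matrix (Fin g ⊕ Fin g) (Fin g ⊕ Fin g) finAdeleQ) *ᵥ adelicVec v =
      (((a⁻¹ : gspFinAdelic δ) : GL (Fin g ⊕ Fin g) finAdeleQ) : Matrix (Fin g ⊕ Fin g) (Fin g ⊕ Fin g) finAdeleQ) *ᵥ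
        adelicVec (((((q : gspRational δ) : GL (Fin g ⊕ Fin g) ℚ)⁻¹ : GL (Fin g ⊕ Fin g) ℚ) :
          Matrix (Fin g ⊕ Fin g) (Fin g ⊕ Fin g) ℚ) *ᵥ v) := by
    simp only [Subgroup.coe_inv, Subgroup.coe_mul, _root_.mul_inv_rev, Units.val_mul, coe_toFinAdelic_inv,
      ← Matrix.mulVec_mulVec, adelicMatrix_mulVec_adelicVec]
  unfold AdelicCongr
  rw [h]

end Move

end SiegelAdelicMarking

end Literature.AlgebraicGeometry.ModuliOfAbelianVarieties

end
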